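import Summits.NavierStokesRegularity.NavierStokesRegularity.Theses.SymmetryModuliCount
import Summits.NavierStokesRegularity.NavierStokesRegularity.Theorems.SymmetryModuliCountAxisymEndLiouville

/-!
# `AxisymEndLiouvilleOfFarPastLedger` (stmt-NavierStokesRegularity-14736): closing file

Route SymmetryModuliCount, support item
`AxisymEndLiouvilleOfFarPastLedger := FarPastLedger → AxisymEndLiouville`
(ledger ⇒ axisymmetric leaf; it gives the `closes` hypothesis hA a second way in, via crux #3).

The consequent is now a theorem of the tree: the crux `AxisymEndLiouville`
(stmt-NavierStokesRegularity-14061) was closed directly by the line `absorbing-axis-swirl-extinction`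
(`Summit.NavierStokesRegularity.NavierStokesRegularity.Theorems.AxisymEndLiouville_of`, p94015).
Hence the implication holds outright — `symmetryModuliCount_axisymEndLiouvilleOfFarPastLedger_proof`
below, which closes the item.

The independent 𝒦-route of the item's proof plan (backward shift ⇒ blow-down in Albritton–Barker's
class 𝒦 ⇒ persistence of singularities ⇒ Seregin–Šverák's axisymmetric Type-I exclusion) is landed
separately and does NOT go through `AxisymEndLiouville_of`:
`AxisymEndLiouvilleOfFarPastLedger.axisymEndLiouvilleOfFarPastLedger_of_slicePressure`
(`…Theorems.SymmetryModuliCountAxisymEndLiouvilleOfFarPastLedgerReduction`, p91572) derives the item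
from the single slice-pressure lemma HA (verbatim the registered stub `stub_fplSlicePressure` of the
crux `FarPastLedger`, stmt-NavierStokesRegularity-14060), with all other inputs instantiated by name
from landed files (`…OfFarPastLedger{Assembly, Pressure, PressureSlice, Cubic, Driver, Endgame}`);
it becomes a second unconditional proof of this decl the moment HA lands.
-/

noncomputable section

-- the summit and its single problem share the name (D-0017 nested layout)
set_option linter.dupNamespace false

namespace Summit.NavierStokesRegularity.NavierStokesRegularity.Theorems

/-- **Item `AxisymEndLiouvilleOfFarPastLedger`** (stmt-NavierStokesRegularity-14736, route
SymmetryModuliCount): `FarPastLedger → AxisymEndLiouville`. Unconditional, because the consequent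
`AxisymEndLiouville` (a Type-I ancient mild field annihilated on a backward end by the rotations about
an axis vanishes on that end) is the tree theorem `AxisymEndLiouville_of` (crux
stmt-NavierStokesRegularity-14061); the ledger hypothesis is not needed for this direction. For the
route through the ledger itself see
`AxisymEndLiouvilleOfFarPastLedger.axisymEndLiouvilleOfFarPastLedger_of_slicePressure`. -/
theorem symmetryModuliCount_axisymEndLiouvilleOfFarPastLedger_proof :
    Summit.NavierStokesRegularity.NavierStokesRegularity.Theses.SymmetryModuliCount.AxisymEndLiouvilleOfFarPastLedger := by
  unfold Summit.NavierStokesRegularity.NavierStokesRegularity.Theses.SymmetryModuliCount.AxisymEndLiouvilleOfFarPastLedger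
  exact fun _ => AxisymEndLiouville_of

end Summit.NavierStokesRegularity.NavierStokesRegularity.Theorems

end
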